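import Summits.QuantumFields.BalabanUV.Beta.D1BFx.GhostRoadWordLetters
import Summits.QuantumFields.BalabanUV.Beta.D1BFx.RestKernelGhostUnit

/-!
# `BalabanUV.Beta.D1BFx.GhostRowBookkeeping` — road «BF-x» for binder row D1, slot (K), GHOST-N8-SPEC v0.2 §3″ FILE F5 PART 2 «ROW BOOKKEEPING»:
# **FROM LEG CONSTANTS `κ ≤ c∕n^e` TO THE WEIGHT-`n⁸` CURRENCY** — the road bubble letter (F5 PART 1) and the road tadpole letter read as
# `Decay510 · (K·(n⁸)⁻¹) ·` and `|secondMoment| ≤ K·(n⁸)⁻¹·Σ'|x|₁²e^{−ρ|x|₁}` with `K` an n-FREE expression in the displayed leg constants, whenever the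
# four power conditions `(8 − pᵢⱼ) + 8 ≤ Eᵢ + Eⱼ` hold (`E = e′ + 3` for a differenced leg, `e + 4` for an undifferenced one)

HONEST DEPENDENCY (cell records, verbatim): «continuum YM on T⁴ ⇐ BetaPertH ∧ nine spine estimates (0/9 proved); BetaPertH ⇐ (D1) ∧ (D4) ∧
CAP+tail; G-an2-4 gates asym, D1 and NE2/3/4.»  HONEST FRAMING (cell contract, verbatim): «discharging `BetaPertH` makes Bałaban's UV stability
UNCONDITIONAL — a real constructive-QFT result; it is NOT the continuum limit and NOT the Clay problem.»  THIS MODULE DISCHARGES NOTHING of the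
wall: [folklore] real arithmetic (`OrientedProfileWords.pow_bookkeeping` ×4) over this seat's F5 PART 1 `GhostRoadWordLetters` and the typer's
`RestKernelGhostUnit.abs_secondMoment_le`; the legs are ARBITRARY with DISPLAYED letters and DISPLAYED n-powers of their constants.  No definition, no
`def … : Prop`, nothing cited, 0 sorry.  0 root-level binders of row D1 discharged (hW ∕ hR-sockets ∕ hSX-socket ∕ D1Tel ∕ D1Rep = 0); (K) NOT closed;
NOT D1, NOT `BetaPertH`, NOT continuum, NOT Clay.

ABSOLUTE RULE (cell charter, verbatim): «No internally-minted statement may enter as a cited fact. Every hypothesis is either kernel-proved in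
this package or a verbatim quotation of a PUBLISHED theorem with page reference. The manuscript(s) under audit are NOT citable for their own
disputed steps — they are the thing under adjudication; programme-internal (2001/route/tribunal) claims are never citable.»

WHY (GHOST-N8-SPEC v0.2 §3″ (O6)∕(O7); journal N-1 [D1LEAF04-G26-N1]).  (O6)'s word table is the statement that for every ghost `P`-word the four power
conditions hold with the leg table (O5): e.g. `(G; P∘G)`: `(3 + 2) + (3 + 5) = 13 = (8 − 3) + 8`, `(4 + 2) + (3 + 5) = 14 = (8 − 2) + 8`, … .  This file turns
that count into a theorem shape once; PART 3 instantiates it twelve times.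

CONTENT ([folklore]; `n = m + 1`, `N := (n : ℝ)`; F4's constants `M₅ := MG163 4·periodConst (kappa163 4) 3·e^{κ₄∕4}`, `M₆ := MD163 4·periodConst (kappa163 4) 3·e^{κ₄∕4}`,
`κ₄ := kappa163 4`, `σ := κ₄∕16`; F2's `c(p)`, `c′` at `ε = min σ (2δ)` — all written out).
* §1 `K_diff_le`, `K_value_le` — F1's majorant constants at F4's densities are `≤ d∕N^{3+e′}` resp. `≤ d∕N^{4+e}` when the leg constant is `≤ c∕N^{e}`.
* §2 **`decay510_road_biBubble_pow`** — F5 PART 1 §1 + §1 + `pow_bookkeeping` ×4: `Decay510 (z ↦ biBubble L₁ (𝒱 μ 0) L₂ (𝒱 ν z)) (KROW·(N⁸)⁻¹) (min σ (2δ)∕2∕4)`;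
  **`abs_secondMoment_road_biBubble_le`**, and the `±½`-prefixed forms **`decay510_road_biBubble_pow_half`** ∕ **`_neg_half`** (the shapes of `ghostWord`).
* §3 **`decay510_road_tadpole_pow`** (`sup|L| ≤ s∕N⁴` ⟹ constant `(|Unit|²·648·s·M₅²·e^{κ₄∕8}·K″)·(N⁸)⁻¹`), **`decay510_road_tadpole_pow_half`**.
NOT HERE (honest): the leg table (F3), the twelve instances (PART 3); anything of the END.
Unit `b2b-balaban-beta-d1-formalise-leaf-04` (gen 26), D1 formalisation swarm, road «BF-x»; INTENT-7 [D1LEAF04-G26-INTENT-7]. Not in print; no existing file touched.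
-/

noncomputable section

namespace Summit.QuantumFields.BalabanUV.Beta.D1BFx.GhostRowBookkeeping

open scoped BigOperators
open Finset
open Literature.MathematicalPhysics.QuantumFieldTheory.Balaban1983to89
open Literature.MathematicalPhysics.QuantumFieldTheory.Balaban1983to89.Beta
open B12Sec2to5 (l1 Decay510)
open ExpKernelCalculus (Site MKer comp tr tadpole decay510_mono_const)
open AffineAveraging (unitVec)
open B4TorusKernel (periodConst)
open B5Hk163Strip (kappa163 kappa163_pos)
open B5Hk163TorusHolderDecay (MD163)
open B5Hk163Decay (MG163)
open PoissonInterior (supNorm nrm nrm_pos)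
open Summit.QuantumFields.BalabanUV.Beta.D1BFx.PackedKernelSplit (biBubble)
open Summit.QuantumFields.BalabanUV.Beta.D1BFx.GhostStencil (ghCur)
open Summit.QuantumFields.BalabanUV.Beta.D1BFx.TorusGhostPairStencils (gh₂)
open Summit.QuantumFields.BalabanUV.Beta.D1BFx.ReducedKernelF (vertexRedF)
open Summit.QuantumFields.BalabanUV.Beta.D1BFx.ReducedTableF (tableRedF)
open Summit.QuantumFields.BalabanUV.Beta.D1BFx.OrientedProfileWords (pow_bookkeeping)
open Summit.QuantumFields.BalabanUV.Beta.D1BFx.GhostRoadWordLetters (decay510_road_biBubble decay510_road_tadpole)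
open Summit.QuantumFields.BalabanUV.Beta.D1BFx.RestKernelGhostUnit (decay510_half_mul decay510_neg_half_mul abs_secondMoment_le momentSum_nonneg)

/-! ## §1 The two majorant constants in the power currency -/

/-- [folklore] **THE DIFFERENCED-LEG CONSTANT**: `κ′ ≤ c′∕N^{e′}`, `1 ≤ N` ⟹
`4(1+2^{a′}e^δ)·(|N²|·((N⁵)⁻¹·M·E))·κ′ ≤ (4(1+2^{a′}e^δ)·(M·E)·c′)∕N^{3+e′}` (`M, E ≥ 0`). -/
theorem K_diff_le {N M E δ κ' c' : ℝ} {a' e' : ℕ} (hN : 1 ≤ N) (hM : 0 ≤ M) (hE : 0 ≤ E) (hc' : κ' ≤ c' / N ^ e') :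
    4 * (1 + 2 ^ a' * Real.exp δ) * (|N ^ 2| * ((N ^ 5)⁻¹ * M * E)) * κ' ≤ (4 * (1 + 2 ^ a' * Real.exp δ) * (M * E) * c') / N ^ (e' + 3) := by
  have hN0 : 0 < N := by linarith
  rw [abs_of_nonneg (by positivity : (0 : ℝ) ≤ N ^ 2)]
  have hpre : 0 ≤ 4 * (1 + 2 ^ a' * Real.exp δ) * (M * E) := by positivity
  have e1 : 4 * (1 + 2 ^ a' * Real.exp δ) * (N ^ 2 * ((N ^ 5)⁻¹ * M * E)) * κ' = (4 * (1 + 2 ^ a' * Real.exp δ) * (M * E)) * (κ' / N ^ 3) := by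
    field_simp
  rw [e1]
  have h2 : κ' / N ^ 3 ≤ c' / N ^ e' / N ^ 3 := div_le_div_of_nonneg_right hc' (by positivity)
  refine (mul_le_mul_of_nonneg_left h2 hpre).trans (le_of_eq ?_)
  rw [div_div, ← pow_add]; ring

/-- [folklore] **THE UNDIFFERENCED-LEG CONSTANT**: `κ ≤ c∕N^{e}`, `1 ≤ N` ⟹ `4·2^a·e^δ·(|N²|·((N⁶)⁻¹·M·E))·κ ≤ (4·2^a·e^δ·(M·E)·c)∕N^{4+e}`. -/
theorem K_value_le {N M E δ κ c : ℝ} {a e : ℕ} (hN : 1 ≤ N) (hM : 0 ≤ M) (hE : 0 ≤ E) (hc : κ ≤ c / N ^ e) :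
    4 * 2 ^ a * Real.exp δ * (|N ^ 2| * ((N ^ 6)⁻¹ * M * E)) * κ ≤ (4 * 2 ^ a * Real.exp δ * (M * E) * c) / N ^ (e + 4) := by
  have hN0 : 0 < N := by linarith
  rw [abs_of_nonneg (by positivity : (0 : ℝ) ≤ N ^ 2)]
  have hpre : 0 ≤ 4 * 2 ^ a * Real.exp δ * (M * E) := by positivity
  have e1 : 4 * 2 ^ a * Real.exp δ * (N ^ 2 * ((N ^ 6)⁻¹ * M * E)) * κ = (4 * 2 ^ a * Real.exp δ * (M * E)) * (κ / N ^ 4) := by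
    field_simp
  rw [e1]
  have h2 : κ / N ^ 4 ≤ c / N ^ e / N ^ 4 := div_le_div_of_nonneg_right hc (by positivity)
  refine (mul_le_mul_of_nonneg_left h2 hpre).trans (le_of_eq ?_)
  rw [div_div, ← pow_add]; ring

/-! ## §2 The road bubble in the power currency -/

section Bubble

variable (m : ℕ) {L₁ L₂ : MKer 4 Unit} {κ₁ κ₁' κ₂ κ₂' c₁ c₁' c₂ c₂' δ : ℝ} {a₁ a₁' a₂ a₂' e₁ e₁' e₂ e₂' : ℕ}
  (hκ₁ : 0 ≤ κ₁) (hκ₁' : 0 ≤ κ₁') (hκ₂ : 0 ≤ κ₂) (hκ₂' : 0 ≤ κ₂') (hδ : 0 < δ)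
  (h11 : a₁' + a₂' ≤ 3) (h12 : a₁' + a₂ ≤ 3) (h21 : a₁ + a₂' ≤ 3) (h22 : a₁ + a₂ ≤ 3)
  (hc₁ : κ₁ ≤ c₁ / ((m + 1 : ℕ) : ℝ) ^ e₁) (hc₁' : κ₁' ≤ c₁' / ((m + 1 : ℕ) : ℝ) ^ e₁')
  (hc₂ : κ₂ ≤ c₂ / ((m + 1 : ℕ) : ℝ) ^ e₂) (hc₂' : κ₂' ≤ c₂' / ((m + 1 : ℕ) : ℝ) ^ e₂')
  (q11 : (2 * 4 - (a₁' + a₂')) + 8 ≤ (e₁' + 3) + (e₂' + 3)) (q12 : (2 * 4 - (a₁' + a₂)) + 8 ≤ (e₁' + 3) + (e₂ + 4))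
  (q21 : (2 * 4 - (a₁ + a₂')) + 8 ≤ (e₁ + 4) + (e₂' + 3)) (q22 : (2 * 4 - (a₁ + a₂)) + 8 ≤ (e₁ + 4) + (e₂ + 4))
  (hL₁ : ∀ x y, |L₁ x y () ()| ≤ κ₁ / nrm (x - y) ^ a₁ * Real.exp (-(δ / ((m + 1 : ℕ) : ℝ)) * supNorm (x - y)))
  (hdL₁ : ∀ x y (μ : Fin 4), |L₁ x (y + unitVec μ) () () - L₁ x y () ()| ≤ κ₁' / nrm (x - y) ^ a₁' * Real.exp (-(δ / ((m + 1 : ℕ) : ℝ)) * supNorm (x - y)))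
  (hL₂ : ∀ x y, |L₂ x y () ()| ≤ κ₂ / nrm (x - y) ^ a₂ * Real.exp (-(δ / ((m + 1 : ℕ) : ℝ)) * supNorm (x - y)))
  (hdL₂ : ∀ x y (μ : Fin 4), |L₂ x (y + unitVec μ) () () - L₂ x y () ()| ≤ κ₂' / nrm (x - y) ^ a₂' * Real.exp (-(δ / ((m + 1 : ℕ) : ℝ)) * supNorm (x - y)))
include hκ₁ hκ₁' hκ₂ hκ₂' hδ h11 h12 h21 h22 hc₁ hc₁' hc₂ hc₂' q11 q12 q21 q22 hL₁ hdL₁ hL₂ hdL₂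

/-- [folklore] **THE ROAD BUBBLE IN THE `n⁻⁸` CURRENCY**: under the displayed leg letters, the displayed powers of their constants and the four power
conditions, `Decay510 (z ↦ biBubble L₁ (𝒱 μ 0) L₂ (𝒱 ν z)) (KROW·(n⁸)⁻¹) (min (κ₄∕16) (2δ)∕2∕4)` with the n-FREE `KROW` displayed. -/
theorem decay510_road_biBubble_pow (μ ν : Fin 4) :
    Decay510 (fun z => biBubble L₁ ((fun κ u => (((m + 1 : ℕ) : ℝ) ^ 2) • vertexRedF (m + 1) (fun κ u => ghCur κ u) κ u) μ 0)
        L₂ ((fun κ u => (((m + 1 : ℕ) : ℝ) ^ 2) • vertexRedF (m + 1) (fun κ u => ghCur κ u) κ u) ν z))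
      (((Fintype.card Unit : ℝ) ^ 2 * (((4 * (1 + 2 ^ a₁' * Real.exp δ) * ((MG163 4 * periodConst (kappa163 4) 3) * Real.exp (kappa163 4 / 4)) * c₁') * (4 * (1 + 2 ^ a₂' * Real.exp δ) * ((MG163 4 * periodConst (kappa163 4) 3) * Real.exp (kappa163 4 / 4)) * c₂') * (2 * (1 + 2 * (4 : ℕ) * 3 ^ ((4 : ℕ) - 1) * (((4 : ℕ) - 1 - (a₁' + a₂')).factorial * (8 / min (kappa163 4 / 16) (2 * δ)) ^ ((4 : ℕ) - 1 - (a₁' + a₂')) * (1 + 8 / min (kappa163 4 / 16) (2 * δ)))))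
          + (4 * (1 + 2 ^ a₁' * Real.exp δ) * ((MG163 4 * periodConst (kappa163 4) 3) * Real.exp (kappa163 4 / 4)) * c₁') * (4 * 2 ^ a₂ * Real.exp δ * (((MD163 4 * periodConst (kappa163 4) 3) * Real.exp (kappa163 4 / 4)) * Real.exp (kappa163 4 / 16)) * c₂) * (2 * (1 + 2 * (4 : ℕ) * 3 ^ ((4 : ℕ) - 1) * (((4 : ℕ) - 1 - (a₁' + a₂)).factorial * (8 / min (kappa163 4 / 16) (2 * δ)) ^ ((4 : ℕ) - 1 - (a₁' + a₂)) * (1 + 8 / min (kappa163 4 / 16) (2 * δ)))))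
          + (4 * 2 ^ a₁ * Real.exp δ * (((MD163 4 * periodConst (kappa163 4) 3) * Real.exp (kappa163 4 / 4)) * Real.exp (kappa163 4 / 16)) * c₁) * (4 * (1 + 2 ^ a₂' * Real.exp δ) * ((MG163 4 * periodConst (kappa163 4) 3) * Real.exp (kappa163 4 / 4)) * c₂') * (2 * (1 + 2 * (4 : ℕ) * 3 ^ ((4 : ℕ) - 1) * (((4 : ℕ) - 1 - (a₁ + a₂')).factorial * (8 / min (kappa163 4 / 16) (2 * δ)) ^ ((4 : ℕ) - 1 - (a₁ + a₂')) * (1 + 8 / min (kappa163 4 / 16) (2 * δ)))))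
          + (4 * 2 ^ a₁ * Real.exp δ * (((MD163 4 * periodConst (kappa163 4) 3) * Real.exp (kappa163 4 / 4)) * Real.exp (kappa163 4 / 16)) * c₁) * (4 * 2 ^ a₂ * Real.exp δ * (((MD163 4 * periodConst (kappa163 4) 3) * Real.exp (kappa163 4 / 4)) * Real.exp (kappa163 4 / 16)) * c₂) * (2 * (1 + 2 * (4 : ℕ) * 3 ^ ((4 : ℕ) - 1) * (((4 : ℕ) - 1 - (a₁ + a₂)).factorial * (8 / min (kappa163 4 / 16) (2 * δ)) ^ ((4 : ℕ) - 1 - (a₁ + a₂)) * (1 + 8 / min (kappa163 4 / 16) (2 * δ))))))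
          * (1 + 2 * (4 : ℕ) * 3 ^ ((4 : ℕ) - 1) * (((4 : ℕ) - 1).factorial * (4 / min (kappa163 4 / 16) (2 * δ)) ^ ((4 : ℕ) - 1) * (1 + 4 / min (kappa163 4 / 16) (2 * δ))))))
        * ((((m + 1 : ℕ) : ℝ)) ^ 8)⁻¹)
      (min (kappa163 4 / 16) (2 * δ) / 2 / (4 : ℕ)) := by
  have hn : 1 ≤ m + 1 := Nat.le_add_left 1 m
  have hN : (1 : ℝ) ≤ ((m + 1 : ℕ) : ℝ) := by exact_mod_cast hn
  have hσ : 0 < kappa163 4 / 16 := by have := kappa163_pos 4; positivity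
  have hε : 0 < min (kappa163 4 / 16) (2 * δ) := lt_min hσ (by linarith)
  have hM5 : 0 ≤ MG163 4 * periodConst (kappa163 4) 3 := by
    -- F4's weight letter is an upper bound of an absolute value with a positive exponential factor
    have h := GhostVertexDensities.abs_ghostWeight_le m 1 μ 0 0 0
    have h1 : 0 ≤ |(1:ℝ)| * ((((m + 1 : ℕ) : ℝ) ^ 5)⁻¹ * (MG163 4 * periodConst (kappa163 4) 3) * Real.exp (kappa163 4 / 4)) :=
      (mul_nonneg_iff_of_pos_right (Real.exp_pos _)).1 ((abs_nonneg _).trans h)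
    rw [abs_one, one_mul] at h1
    have h2 : 0 < (((m + 1 : ℕ) : ℝ) ^ 5)⁻¹ := by positivity
    have h3 := (mul_nonneg_iff_of_pos_right (Real.exp_pos _)).1 h1
    exact (mul_nonneg_iff_of_pos_left h2).1 h3
  have hM6 : 0 ≤ MD163 4 * periodConst (kappa163 4) 3 := by
    have h := GhostVertexDensities.abs_ghostWeight_sub_le m 1 μ 0 0 0
    have h1 : 0 ≤ |(1:ℝ)| * ((((m + 1 : ℕ) : ℝ) ^ 6)⁻¹ * ((MD163 4 * periodConst (kappa163 4) 3) * Real.exp (kappa163 4 / 4)) * Real.exp (kappa163 4 / 16)) :=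
      (mul_nonneg_iff_of_pos_right (Real.exp_pos _)).1 ((abs_nonneg _).trans h)
    rw [abs_one, one_mul] at h1
    have h2 : 0 < (((m + 1 : ℕ) : ℝ) ^ 6)⁻¹ := by positivity
    have h3 := (mul_nonneg_iff_of_pos_right (Real.exp_pos _)).1 h1
    have h4 := (mul_nonneg_iff_of_pos_left h2).1 h3
    exact (mul_nonneg_iff_of_pos_right (Real.exp_pos _)).1 h4
  -- the four majorant constants in the power currency
  have hK₁ := K_diff_le (a' := a₁') (δ := δ) hN hM5 (Real.exp_pos (kappa163 4 / 4)).le hc₁'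
  have hK₂ := K_value_le (a := a₁) (δ := δ) hN (mul_nonneg hM6 (Real.exp_pos (kappa163 4 / 4)).le) (Real.exp_pos (kappa163 4 / 16)).le hc₁
  have hK₃ := K_diff_le (a' := a₂') (δ := δ) hN hM5 (Real.exp_pos (kappa163 4 / 4)).le hc₂'
  have hK₄ := K_value_le (a := a₂) (δ := δ) hN (mul_nonneg hM6 (Real.exp_pos (kappa163 4 / 4)).le) (Real.exp_pos (kappa163 4 / 16)).le hc₂
  refine decay510_mono_const (decay510_road_biBubble m hκ₁ hκ₁' hκ₂ hκ₂' hδ h11 h12 h21 h22 hL₁ hdL₁ hL₂ hdL₂ μ ν) ?_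
  -- positivity of all the letters
  have hF : 0 ≤ (Fintype.card Unit : ℝ) ^ 2 := by positivity
  have hc' : 0 ≤ 1 + 2 * ((4 : ℕ) : ℝ) * 3 ^ ((4 : ℕ) - 1) * ((((4 : ℕ) - 1).factorial : ℕ) * (4 / min (kappa163 4 / 16) (2 * δ)) ^ ((4 : ℕ) - 1) * (1 + 4 / min (kappa163 4 / 16) (2 * δ))) := by positivity
  have hcp : ∀ p : ℕ, 0 ≤ 2 * (1 + 2 * ((4 : ℕ) : ℝ) * 3 ^ ((4 : ℕ) - 1) * ((((4 : ℕ) - 1 - p).factorial : ℕ) * (8 / min (kappa163 4 / 16) (2 * δ)) ^ ((4 : ℕ) - 1 - p) * (1 + 8 / min (kappa163 4 / 16) (2 * δ)))) :=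
    fun p => by positivity
  have hK₁0 : 0 ≤ 4 * (1 + 2 ^ a₁' * Real.exp δ) * (|(((m + 1 : ℕ) : ℝ)) ^ 2| * ((((m + 1 : ℕ) : ℝ) ^ 5)⁻¹ * (MG163 4 * periodConst (kappa163 4) 3) * Real.exp (kappa163 4 / 4))) * κ₁' := by positivity
  have hK₂0 : 0 ≤ 4 * 2 ^ a₁ * Real.exp δ * (|(((m + 1 : ℕ) : ℝ)) ^ 2| * ((((m + 1 : ℕ) : ℝ) ^ 6)⁻¹ * ((MD163 4 * periodConst (kappa163 4) 3) * Real.exp (kappa163 4 / 4)) * Real.exp (kappa163 4 / 16))) * κ₁ := by positivity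
  have hK₃0 : 0 ≤ 4 * (1 + 2 ^ a₂' * Real.exp δ) * (|(((m + 1 : ℕ) : ℝ)) ^ 2| * ((((m + 1 : ℕ) : ℝ) ^ 5)⁻¹ * (MG163 4 * periodConst (kappa163 4) 3) * Real.exp (kappa163 4 / 4))) * κ₂' := by positivity
  have hK₄0 : 0 ≤ 4 * 2 ^ a₂ * Real.exp δ * (|(((m + 1 : ℕ) : ℝ)) ^ 2| * ((((m + 1 : ℕ) : ℝ) ^ 6)⁻¹ * ((MD163 4 * periodConst (kappa163 4) 3) * Real.exp (kappa163 4 / 4)) * Real.exp (kappa163 4 / 16))) * κ₂ := by positivity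
  -- the four power bookkeepings
  have t11 := pow_bookkeeping hn hK₁0 hK₃0 (hcp (a₁' + a₂')) hK₁ hK₃ q11
  have t12 := pow_bookkeeping hn hK₁0 hK₄0 (hcp (a₁' + a₂)) hK₁ hK₄ q12
  have t21 := pow_bookkeeping hn hK₂0 hK₃0 (hcp (a₁ + a₂')) hK₂ hK₃ q21
  have t22 := pow_bookkeeping hn hK₂0 hK₄0 (hcp (a₁ + a₂)) hK₂ hK₄ q22
  have hsum := add_le_add (add_le_add (add_le_add t11 t12) t21) t22
  have := mul_le_mul_of_nonneg_left (mul_le_mul_of_nonneg_right hsum hc') hF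
  refine le_trans (le_of_eq ?_) (this.trans (le_of_eq ?_)) <;> ring

/-- [folklore] … with the prefactor `−½` (the single-`P` bubble words of `ghostWord`). -/
theorem decay510_road_biBubble_pow_neg_half (μ ν : Fin 4) :
    Decay510 (fun z => -(1 / 2) * biBubble L₁ ((fun κ u => (((m + 1 : ℕ) : ℝ) ^ 2) • vertexRedF (m + 1) (fun κ u => ghCur κ u) κ u) μ 0)
        L₂ ((fun κ u => (((m + 1 : ℕ) : ℝ) ^ 2) • vertexRedF (m + 1) (fun κ u => ghCur κ u) κ u) ν z))
      ((1 / 2) * (((Fintype.card Unit : ℝ) ^ 2 * (((4 * (1 + 2 ^ a₁' * Real.exp δ) * ((MG163 4 * periodConst (kappa163 4) 3) * Real.exp (kappa163 4 / 4)) * c₁') * (4 * (1 + 2 ^ a₂' * Real.exp δ) * ((MG163 4 * periodConst (kappa163 4) 3) * Real.exp (kappa163 4 / 4)) * c₂') * (2 * (1 + 2 * (4 : ℕ) * 3 ^ ((4 : ℕ) - 1) * (((4 : ℕ) - 1 - (a₁' + a₂')).factorial * (8 / min (kappa163 4 / 16) (2 * δ)) ^ ((4 : ℕ) - 1 - (a₁'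 + a₂')) * (1 + 8 / min (kappa163 4 / 16) (2 * δ)))))
          + (4 * (1 + 2 ^ a₁' * Real.exp δ) * ((MG163 4 * periodConst (kappa163 4) 3) * Real.exp (kappa163 4 / 4)) * c₁') * (4 * 2 ^ a₂ * Real.exp δ * (((MD163 4 * periodConst (kappa163 4) 3) * Real.exp (kappa163 4 / 4)) * Real.exp (kappa163 4 / 16)) * c₂) * (2 * (1 + 2 * (4 : ℕ) * 3 ^ ((4 : ℕ) - 1) * (((4 : ℕ) - 1 - (a₁' + a₂)).factorial * (8 / min (kappa163 4 / 16) (2 * δ)) ^ ((4 : ℕ) - 1 - (a₁' + a₂)) * (1 + 8 / min (kappa163 4 / 16) (2 * δ)))))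
          + (4 * 2 ^ a₁ * Real.exp δ * (((MD163 4 * periodConst (kappa163 4) 3) * Real.exp (kappa163 4 / 4)) * Real.exp (kappa163 4 / 16)) * c₁) * (4 * (1 + 2 ^ a₂' * Real.exp δ) * ((MG163 4 * periodConst (kappa163 4) 3) * Real.exp (kappa163 4 / 4)) * c₂') * (2 * (1 + 2 * (4 : ℕ) * 3 ^ ((4 : ℕ) - 1) * (((4 : ℕ) - 1 - (a₁ + a₂')).factorial * (8 / min (kappa163 4 / 16) (2 * δ)) ^ ((4 : ℕ) - 1 - (a₁ + a₂')) * (1 + 8 / min (kappa163 4 / 16) (2 * δ)))))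
          + (4 * 2 ^ a₁ * Real.exp δ * (((MD163 4 * periodConst (kappa163 4) 3) * Real.exp (kappa163 4 / 4)) * Real.exp (kappa163 4 / 16)) * c₁) * (4 * 2 ^ a₂ * Real.exp δ * (((MD163 4 * periodConst (kappa163 4) 3) * Real.exp (kappa163 4 / 4)) * Real.exp (kappa163 4 / 16)) * c₂) * (2 * (1 + 2 * (4 : ℕ) * 3 ^ ((4 : ℕ) - 1) * (((4 : ℕ) - 1 - (a₁ + a₂)).factorial * (8 / min (kappa163 4 / 16) (2 * δ)) ^ ((4 : ℕ) - 1 - (a₁ + a₂)) * (1 + 8 / min (kappa163 4 / 16) (2 * δ))))))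
          * (1 + 2 * (4 : ℕ) * 3 ^ ((4 : ℕ) - 1) * (((4 : ℕ) - 1).factorial * (4 / min (kappa163 4 / 16) (2 * δ)) ^ ((4 : ℕ) - 1) * (1 + 4 / min (kappa163 4 / 16) (2 * δ))))))
        * ((((m + 1 : ℕ) : ℝ)) ^ 8)⁻¹))
      (min (kappa163 4 / 16) (2 * δ) / 2 / (4 : ℕ)) :=
  decay510_neg_half_mul (decay510_road_biBubble_pow m hκ₁ hκ₁' hκ₂ hκ₂' hδ h11 h12 h21 h22 hc₁ hc₁' hc₂ hc₂' q11 q12 q21 q22 hL₁ hdL₁ hL₂ hdL₂ μ ν)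

/-- [folklore] … with the prefactor `+½` (the double-`P` bubble words of `ghostWord`). -/
theorem decay510_road_biBubble_pow_half (μ ν : Fin 4) :
    Decay510 (fun z => (1 / 2) * biBubble L₁ ((fun κ u => (((m + 1 : ℕ) : ℝ) ^ 2) • vertexRedF (m + 1) (fun κ u => ghCur κ u) κ u) μ 0)
        L₂ ((fun κ u => (((m + 1 : ℕ) : ℝ) ^ 2) • vertexRedF (m + 1) (fun κ u => ghCur κ u) κ u) ν z))
      ((1 / 2) * (((Fintype.card Unit : ℝ) ^ 2 * (((4 * (1 + 2 ^ a₁' * Real.exp δ) * ((MG163 4 * periodConst (kappa163 4) 3) * Real.exp (kappa163 4 / 4)) * c₁') * (4 * (1 + 2 ^ a₂' * Real.exp δ) * ((MG163 4 * periodConst (kappa163 4) 3) * Real.exp (kappa163 4 / 4)) * c₂') * (2 * (1 + 2 * (4 : ℕ) * 3 ^ ((4 : ℕ) - 1) * (((4 : ℕ) - 1 - (a₁' + a₂')).factorial * (8 / min (kappa163 4 / 16) (2 * δ)) ^ ((4 : ℕ) - 1 - (a₁' + a₂')) * (1 + 8 / min (kappa163 4 / 16) (2 * δ)))))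
          + (4 * (1 + 2 ^ a₁' * Real.exp δ) * ((MG163 4 * periodConst (kappa163 4) 3) * Real.exp (kappa163 4 / 4)) * c₁') * (4 * 2 ^ a₂ * Real.exp δ * (((MD163 4 * periodConst (kappa163 4) 3) * Real.exp (kappa163 4 / 4)) * Real.exp (kappa163 4 / 16)) * c₂) * (2 * (1 + 2 * (4 : ℕ) * 3 ^ ((4 : ℕ) - 1) * (((4 : ℕ) - 1 - (a₁' + a₂)).factorial * (8 / min (kappa163 4 / 16) (2 * δ)) ^ ((4 : ℕ) - 1 - (a₁' + a₂)) * (1 + 8 / min (kappa163 4 / 16) (2 * δ)))))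
          + (4 * 2 ^ a₁ * Real.exp δ * (((MD163 4 * periodConst (kappa163 4) 3) * Real.exp (kappa163 4 / 4)) * Real.exp (kappa163 4 / 16)) * c₁) * (4 * (1 + 2 ^ a₂' * Real.exp δ) * ((MG163 4 * periodConst (kappa163 4) 3) * Real.exp (kappa163 4 / 4)) * c₂') * (2 * (1 + 2 * (4 : ℕ) * 3 ^ ((4 : ℕ) - 1) * (((4 : ℕ) - 1 - (a₁ + a₂')).factorial * (8 / min (kappa163 4 / 16) (2 * δ)) ^ ((4 : ℕ) - 1 - (a₁ + a₂')) * (1 + 8 / min (kappa163 4 / 16) (2 * δ)))))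
          + (4 * 2 ^ a₁ * Real.exp δ * (((MD163 4 * periodConst (kappa163 4) 3) * Real.exp (kappa163 4 / 4)) * Real.exp (kappa163 4 / 16)) * c₁) * (4 * 2 ^ a₂ * Real.exp δ * (((MD163 4 * periodConst (kappa163 4) 3) * Real.exp (kappa163 4 / 4)) * Real.exp (kappa163 4 / 16)) * c₂) * (2 * (1 + 2 * (4 : ℕ) * 3 ^ ((4 : ℕ) - 1) * (((4 : ℕ) - 1 - (a₁ + a₂)).factorial * (8 / min (kappa163 4 / 16) (2 * δ)) ^ ((4 : ℕ) - 1 - (a₁ + a₂)) * (1 + 8 / min (kappa163 4 / 16) (2 * δ))))))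
          * (1 + 2 * (4 : ℕ) * 3 ^ ((4 : ℕ) - 1) * (((4 : ℕ) - 1).factorial * (4 / min (kappa163 4 / 16) (2 * δ)) ^ ((4 : ℕ) - 1) * (1 + 4 / min (kappa163 4 / 16) (2 * δ))))))
        * ((((m + 1 : ℕ) : ℝ)) ^ 8)⁻¹))
      (min (kappa163 4 / 16) (2 * δ) / 2 / (4 : ℕ)) :=
  decay510_half_mul (decay510_road_biBubble_pow m hκ₁ hκ₁' hκ₂ hκ₂' hδ h11 h12 h21 h22 hc₁ hc₁' hc₂ hc₂' q11 q12 q21 q22 hL₁ hdL₁ hL₂ hdL₂ μ ν)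

end Bubble

/-! ## §3 The road tadpole in the power currency -/

/-- [folklore] **THE ROAD TADPOLE IN THE `n⁻⁸` CURRENCY**: a leg with `|L x y| ≤ S`, `0 ≤ S ≤ s∕n⁴` against the road's ghost pair table:
`Decay510 (z ↦ ½·tadpole L (𝒲 μ 0 ν z)) (½·(|Unit|²·(648·s·M₅²·e^{κ₄∕8}·K″(σ)))·(n⁸)⁻¹) (σ∕2∕4)`. -/
theorem decay510_road_tadpole_pow_half (m : ℕ) {L : MKer 4 Unit} {S s : ℝ} (hS : 0 ≤ S) (hs : S ≤ s / ((m + 1 : ℕ) : ℝ) ^ 4)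
    (hL : ∀ x y (g f : Unit), |L x y g f| ≤ S) (μ ν : Fin 4) :
    Decay510 (fun z => (1 / 2) * tadpole L ((fun κ u l u' => (((m + 1 : ℕ) : ℝ) ^ 2) • tableRedF (m + 1)
        (fun κ u l u' => if u = u' ∧ κ = l then gh₂ κ u else (0 : MKer 4 Unit)) κ u l u') μ 0 ν z))
      ((1 / 2) * (((Fintype.card Unit : ℝ) ^ 2 * (648 * s * ((MG163 4 * periodConst (kappa163 4) 3) * Real.exp (kappa163 4 / 4)) ^ 2 * Real.exp (kappa163 4 / 8)
        * (1 + 2 * (4 : ℕ) * 3 ^ ((4 : ℕ) - 1) * (((4 : ℕ) - 1).factorial * (4 / (kappa163 4 / 16)) ^ ((4 : ℕ) - 1) * (1 + 4 / (kappa163 4 / 16))))))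
        * ((((m + 1 : ℕ) : ℝ)) ^ 8)⁻¹))
      (kappa163 4 / 16 / 2 / (4 : ℕ)) := by
  have hn : 1 ≤ m + 1 := Nat.le_add_left 1 m
  have hN : (1 : ℝ) ≤ ((m + 1 : ℕ) : ℝ) := by exact_mod_cast hn
  have hN0 : (0 : ℝ) < ((m + 1 : ℕ) : ℝ) := by linarith
  refine decay510_half_mul (decay510_mono_const (decay510_road_tadpole m hS hL μ ν) ?_)
  have hs0 : 0 ≤ s := by
    have := hS.trans hs; rw [le_div_iff₀ (by positivity)] at this; nlinarith [pow_pos hN0 4]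
  have hK'' : 0 ≤ 1 + 2 * ((4 : ℕ) : ℝ) * 3 ^ ((4 : ℕ) - 1) * ((((4 : ℕ) - 1).factorial : ℕ) * (4 / (kappa163 4 / 16)) ^ ((4 : ℕ) - 1) * (1 + 4 / (kappa163 4 / 16))) := by
    have := kappa163_pos 4; positivity
  set M : ℝ := (MG163 4 * periodConst (kappa163 4) 3) * Real.exp (kappa163 4 / 4) with hM
  set N : ℝ := ((m + 1 : ℕ) : ℝ) with hNdef
  rw [abs_of_nonneg (by positivity : (0 : ℝ) ≤ N ^ 2)]
  -- `S·3⁴·(N²·8·((N⁵)⁻¹M)²·E)·K″·N⁴ ≤ 648·s·M²·E·K″·(N⁸)⁻¹`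
  have key : S * (2 * ((1 : ℕ) : ℝ) + 1) ^ 4 * (N ^ 2 * (8 * ((N ^ 5)⁻¹ * (MG163 4 * periodConst (kappa163 4) 3) * Real.exp (kappa163 4 / 4)) ^ 2 * Real.exp (kappa163 4 / 8)))
      * (1 + 2 * ((4 : ℕ) : ℝ) * 3 ^ ((4 : ℕ) - 1) * ((((4 : ℕ) - 1).factorial : ℕ) * (4 / (kappa163 4 / 16)) ^ ((4 : ℕ) - 1) * (1 + 4 / (kappa163 4 / 16)))) * N ^ 4
      ≤ 648 * s * M ^ 2 * Real.exp (kappa163 4 / 8)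
        * (1 + 2 * ((4 : ℕ) : ℝ) * 3 ^ ((4 : ℕ) - 1) * ((((4 : ℕ) - 1).factorial : ℕ) * (4 / (kappa163 4 / 16)) ^ ((4 : ℕ) - 1) * (1 + 4 / (kappa163 4 / 16)))) * (N ^ 8)⁻¹ := by
    have e1 : S * (2 * ((1 : ℕ) : ℝ) + 1) ^ 4 * (N ^ 2 * (8 * ((N ^ 5)⁻¹ * (MG163 4 * periodConst (kappa163 4) 3) * Real.exp (kappa163 4 / 4)) ^ 2 * Real.exp (kappa163 4 / 8)))
        * (1 + 2 * ((4 : ℕ) : ℝ) * 3 ^ ((4 : ℕ) - 1) * ((((4 : ℕ) - 1).factorial : ℕ) * (4 / (kappa163 4 / 16)) ^ ((4 : ℕ) - 1) * (1 + 4 / (kappa163 4 / 16)))) * N ^ 4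
        = S * N ^ 4 * (648 * M ^ 2 * Real.exp (kappa163 4 / 8)
          * (1 + 2 * ((4 : ℕ) : ℝ) * 3 ^ ((4 : ℕ) - 1) * ((((4 : ℕ) - 1).factorial : ℕ) * (4 / (kappa163 4 / 16)) ^ ((4 : ℕ) - 1) * (1 + 4 / (kappa163 4 / 16)))) * (N ^ 8)⁻¹) := by
      rw [hM]; field_simp; ring
    rw [e1]
    have h2 : S * N ^ 4 ≤ s := by
      have := mul_le_mul_of_nonneg_right hs (pow_nonneg hN0.le 4)
      rwa [div_mul_cancel₀ _ (pow_ne_zero 4 hN0.ne')] at this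
    have h3 : 0 ≤ 648 * M ^ 2 * Real.exp (kappa163 4 / 8)
        * (1 + 2 * ((4 : ℕ) : ℝ) * 3 ^ ((4 : ℕ) - 1) * ((((4 : ℕ) - 1).factorial : ℕ) * (4 / (kappa163 4 / 16)) ^ ((4 : ℕ) - 1) * (1 + 4 / (kappa163 4 / 16)))) * (N ^ 8)⁻¹ := by
      positivity
    calc S * N ^ 4 * _ ≤ s * _ := mul_le_mul_of_nonneg_right h2 h3
      _ = _ := by ring
  have hF : 0 ≤ (Fintype.card Unit : ℝ) ^ 2 := by positivity
  have := mul_le_mul_of_nonneg_left key hF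
  refine le_trans (le_of_eq ?_) (this.trans (le_of_eq ?_))
  · simp only [hNdef]
  · rw [hM]; ring

end Summit.QuantumFields.BalabanUV.Beta.D1BFx.GhostRowBookkeeping

end
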